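import Summits.QuantumFields.BalabanUV.Beta.D1BFx.TwoPointEnds
import Summits.QuantumFields.BalabanUV.Beta.D1BFx.GradedBubbleTerms

/-!
# `BalabanUV.Beta.D1BFx.TwoPointFrozen` — road «BF-x» for binder row D1, «A3.c ∕ L-X TAILS» PART II (I1): end differences of TRANSLATION-INVARIANT
# two-point kernels `(x, y) ↦ g (y − x)` ARE an3's one-variable iterated differences (static steps negated), and sup bounds double per end step

HONEST DEPENDENCY (page 1, mandatory): continuum YM on T⁴ ⇐ BetaPertH ∧ nine spine estimates (0/9 proved); BetaPertH ⇐ (D1) ∧ (D4) ∧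
CAP+tail; G-an2-4 gates asym, D1 and NE2/3/4.  HONEST FRAMING (cell contract, verbatim): «discharging `BetaPertH` makes Bałaban's UV
stability UNCONDITIONAL — a real constructive-QFT result; it is NOT the continuum limit and NOT the Clay problem.»  THIS MODULE DISCHARGES
NOTHING of the wall: [folklore] identities and a sup bound about ARBITRARY functions, over part (F1) `TwoPointEnds` (`itL`, `itR`) and part (A)
`GradedBubbleTerms` (`iterD_append`, `iterD_const_apply`), an3's `GradedBubbles.iterD`.  No `def`, no `Prop` minted, nothing cited, 0 sorry.  0 wall
binders; NOT an A3.c row, NOT (K), NOT D1, NOT `BetaPertH`, NOT continuum, NOT Clay.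

ABSOLUTE RULE (cell charter, verbatim): «No internally-minted statement may enter as a cited fact. Every hypothesis is either kernel-proved in
this package or a verbatim quotation of a PUBLISHED theorem with page reference. The manuscript(s) under audit are NOT citable for their own
disputed steps — they are the thing under adjudication; programme-internal (2001/route/tribunal) claims are never citable.»

WHY (this lineage's N-d1leaf03g12-2): the frozen piece `legPiece 0 = frozenLeg gfrz` and the frozen half of `legPiece 1` are translation invariant, so
their two-point end differences reduce to part (B)∕(C2)'s one-variable legs of the profile (a static step `e` on the first argument is the moving step
`−e`); the flat pieces are bounded crudely beyond their first step by sup doubling.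
* [folklore] `abs_itR_le_of_sup`, `abs_itL_le_of_sup`, **`abs_itL_itR_le_of_sup`** (`2^{|sL|+|sR|}·M`); `itR_transl`, `itL_transl`,
  **`itL_itR_transl`** (`itL sL (itR sR (fun x y ↦ g (y − x))) x (x + u) = iterD (sR ++ sL.map Neg.neg) g u`), `steps_append_neg`.
Unit `b2b-balaban-beta-d1-formalise-leaf-03` (gen 12), D1 formalisation swarm; `LEAVES-BFx.md` row «A3.c ∕ L-X TAILS» PART II (I1).
-/

noncomputable section

namespace Summit.QuantumFields.BalabanUV.Beta.D1BFx.TwoPointFrozen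

open Literature.MathematicalPhysics.QuantumFieldTheory.Balaban1983to89.Beta
open DyadicShell (Pt)
open GradedBubbles (Fam fdiffF iterD IsStep)
open GradedBubbleTerms (iterD_append iterD_const_apply)
open ScaleLegRows (iterD_const_cons)
open TwoPointEnds (SKer itL itR)

/-! ## §1 Sup bounds double per end step -/

/-- [folklore] `|K| ≤ M ⇒ |itR sR K| ≤ 2^{|sR|}·M`. -/
theorem abs_itR_le_of_sup {K : SKer} {M : ℝ} (h : ∀ x y, |K x y| ≤ M) (sR : List Pt) (x y : Pt) : |itR sR K x y| ≤ 2 ^ sR.length * M := by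
  induction sR generalizing K M with
  | nil => simpa [itR] using h x y
  | cons e sR ih =>
      show |itR sR (fun x y => K x (y + e) - K x y) x y| ≤ _
      rw [List.length_cons, pow_succ]
      have h' : ∀ x y, |(fun x y => K x (y + e) - K x y) x y| ≤ 2 * M := fun x y =>
        (abs_sub _ _).trans (by have := h x (y + e); have := h x y; linarith)
      calc |itR sR (fun x y => K x (y + e) - K x y) x y| ≤ 2 ^ sR.length * (2 * M) := ih h'
        _ = 2 ^ sR.length * 2 * M := by ring

/-- [folklore] `|K| ≤ M ⇒ |itL sL K| ≤ 2^{|sL|}·M`. -/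
theorem abs_itL_le_of_sup {K : SKer} {M : ℝ} (h : ∀ x y, |K x y| ≤ M) (sL : List Pt) (x y : Pt) : |itL sL K x y| ≤ 2 ^ sL.length * M := by
  induction sL generalizing K M with
  | nil => simpa [itL] using h x y
  | cons e sL ih =>
      show |itL sL (fun x y => K (x + e) y - K x y) x y| ≤ _
      rw [List.length_cons, pow_succ]
      have h' : ∀ x y, |(fun x y => K (x + e) y - K x y) x y| ≤ 2 * M := fun x y =>
        (abs_sub _ _).trans (by have := h (x + e) y; have := h x y; linarith)
      calc |itL sL (fun x y => K (x + e) y - K x y) x y| ≤ 2 ^ sL.length * (2 * M) := ih h'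
        _ = 2 ^ sL.length * 2 * M := by ring

/-- [folklore] **SUP BOUNDS DOUBLE PER END STEP**: `|K| ≤ M ⇒ |itL sL (itR sR K)| ≤ 2^{|sL|+|sR|}·M`. -/
theorem abs_itL_itR_le_of_sup {K : SKer} {M : ℝ} (h : ∀ x y, |K x y| ≤ M) (sL sR : List Pt) (x y : Pt) :
    |itL sL (itR sR K) x y| ≤ 2 ^ (sL.length + sR.length) * M := by
  have h1 := abs_itL_le_of_sup (fun x y => abs_itR_le_of_sup h sR x y) sL x y
  rw [pow_add]
  calc |itL sL (itR sR K) x y| ≤ 2 ^ sL.length * (2 ^ sR.length * M) := h1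
    _ = 2 ^ sL.length * 2 ^ sR.length * M := by ring

/-! ## §2 Translation-invariant kernels: end differences are one-variable differences -/

/-- [folklore] **MOVING STEPS** of `(x, y) ↦ g (y − x)`: `itR sR (fun x y ↦ g (y − x)) = fun x y ↦ (iterD sR g) (y − x)`. -/
theorem itR_transl (sR : List Pt) (g : Pt → ℝ) :
    itR sR (fun x y => g (y - x)) = fun x y => iterD sR (fun (_ : ℕ) (_ : ℕ) => g) 0 0 (y - x) := by
  induction sR generalizing g with
  | nil => rfl
  | cons e sR ih =>
      show itR sR (fun x y => g (y + e - x) - g (y - x)) = _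
      have e1 : (fun x y : Pt => g (y + e - x) - g (y - x)) = fun x y => (fun u => g (u + e) - g u) (y - x) := by
        funext x y
        rw [show y + e - x = y - x + e by abel]
      rw [e1, ih (fun u => g (u + e) - g u), iterD_const_cons]

/-- [folklore] **STATIC STEPS** of `(x, y) ↦ m (y − x)`: `itL sL (fun x y ↦ m (y − x)) = fun x y ↦ (iterD (sL.map Neg.neg) m) (y − x)`. -/
theorem itL_transl (sL : List Pt) (m : Pt → ℝ) :
    itL sL (fun x y => m (y - x)) = fun x y => iterD (sL.map Neg.neg) (fun (_ : ℕ) (_ : ℕ) => m) 0 0 (y - x) := by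
  induction sL generalizing m with
  | nil => rfl
  | cons e sL ih =>
      show itL sL (fun x y => m (y - (x + e)) - m (y - x)) = _
      have e1 : (fun x y : Pt => m (y - (x + e)) - m (y - x)) = fun x y => (fun u => m (u + -e) - m u) (y - x) := by
        funext x y
        rw [show y - (x + e) = y - x + -e by abel]
      rw [e1, ih (fun u => m (u + -e) - m u), List.map_cons, iterD_const_cons]

/-- [folklore] **END DIFFERENCES OF A TRANSLATION-INVARIANT KERNEL ARE an3's ITERATED DIFFERENCES OF THE PROFILE** (static steps negated):
`itL sL (itR sR (fun x y ↦ g (y − x))) x (x + u) = iterD (sR ++ sL.map Neg.neg) g u`. -/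
theorem itL_itR_transl (sL sR : List Pt) (g : Pt → ℝ) (x u : Pt) :
    itL sL (itR sR (fun x y => g (y - x))) x (x + u) = iterD (sR ++ sL.map Neg.neg) (fun (_ : ℕ) (_ : ℕ) => g) 0 0 u := by
  rw [itR_transl, itL_transl, iterD_append]
  simp only [add_sub_cancel_left]
  have e : (fun (_ : ℕ) (_ : ℕ) => fun w => iterD sR (fun (_ : ℕ) (_ : ℕ) => g) 0 0 w : Fam) = iterD sR (fun (_ : ℕ) (_ : ℕ) => g) := by
    funext L k w
    exact (iterD_const_apply sR g L k w).symm
  rw [e]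

/-- [folklore] The combined step list consists of unit steps and has length `|sR| + |sL|`. -/
theorem steps_append_neg {sL sR : List Pt} (hsL : ∀ e ∈ sL, IsStep e) (hsR : ∀ e ∈ sR, IsStep e) :
    (∀ e ∈ sR ++ sL.map Neg.neg, IsStep e) ∧ (sR ++ sL.map Neg.neg).length = sR.length + sL.length := by
  refine ⟨fun e he => ?_, by simp⟩
  rcases List.mem_append.mp he with h | h
  · exact hsR e h
  · obtain ⟨e', he', rfl⟩ := List.mem_map.mp h
    exact (hsL e' he').neg

end Summit.QuantumFields.BalabanUV.Beta.D1BFx.TwoPointFrozen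

end
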